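import Summits.HodgeConjecture.HodgeConjecture.Theorems.VHCAbelianSchemesRoadServedFibreDefs
import Summits.HodgeConjecture.HodgeConjecture.Theorems.VHCAbelianSchemesRoadDesignSufficient
import HarnessLib

/-!
# Road b02 (`VHCAbelianSchemesRoad`) — THE SERVED-FIBRE PARTITION OF A CELL `(n, p)`: anchored carrier ∧ residual ⟹ cell (anchor-generic)

research route conditional on HC_CM; not a corollary; Q11.4-sentence-2 already refuted in dim ≥ 3.

Door-generic (`𝒪 : ObjClass`), degree-generic (`(n, p)`), ANCHOR-generic (`𝔄 : Π X, H²(X(ℂ); ℂ) → Prop` an anchor predicate on polarised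
varieties, `𝔖 : Π X θ, Set H^{2p}(X(ℂ); ℂ)` the served classes) and FACT-FREE. With the constants of `VHCAbelianSchemesRoadServedFibreDefs`:

* §1 PARTITION LOGIC. `lefAtExceptionalRegimeAt_of_under_of_under_not : …Under 𝒪 n p P → …Under 𝒪 n p ¬P → LefAtExceptionalRegimeAt 𝒪 n p`
  (excluded middle on `P f W`), its converse `under_of_lefAtExceptionalRegimeAt` (no slack), the `iff`; `under_mono` (the conditional cell is
  antitone in `P`), `under_congr`, `under_or_iff` (`Under (P ∨ Q) ↔ Under P ∧ Under Q`: with TWO anchor families the residual is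
  `Under (¬P ∧ ¬Q)`), `under_true_iff`, `under_of_forall_not` (an unsatisfiable `P` gives a vacuous piece).
* §2 TRANSPORT AND GLUE. `exists_lefAtDatum_of_anchoredCarrierAt` — on ANY smooth projective family with a served fibre for a fibrewise rational
  `(p,p)` class `W`, the anchored carrier statement delivers the conclusion of K-SR♭∃ for `(f, W)` (PART Z-b §5 `exists_lefAtDatum_of_pinnedDatum_at`
  with `Θ :=` the served fibre's global class and `s₁ :=` the served fibre; no regime hypothesis is used); hence
  **`under_hasServedFibre_of_anchoredCarrierAt : AnchoredCarrierAt 𝒪 n p 𝔄 𝔖 → LefAtExceptionalRegimeAtUnder 𝒪 n p (HasServedFibre n p 𝔄 𝔖)`**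
  and **`lefAtExceptionalRegimeAt_of_anchoredCarrierAt_of_under_not`: anchored carrier ∧ residual ⟹ the cell**, with the `(6, 3)` rung form
  `lefAtExceptionalRegimeSixfoldMiddle_of_anchoredCarrierAt_of_under_not` and the both-regimes form when every pencil is served.
* §3 MONOTONICITY IN THE ANCHOR DATA (finding F1 of the LEAD's nod made structural): enlarging `(𝔄, 𝔖)` makes `HasServedFibre` weaker to refute
  (`hasServedFibre_mono`), the carrier statement STRONGER (`anchoredCarrierAt_anti`) and the residual WEAKER (`under_not_hasServedFibre_mono`);
  `under_not_iff_under_not_and_under_sdiff`: the residual of the smaller served set = the residual of the larger one ∧ the pencils served by the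
  larger set only — «unserved anchor directions are one more residual sub-cell», by logic.
* §4 THE TWO EXTREMES AND THE PINNED DESIGNS. No anchors: the residual IS the cell (`under_not_hasServedFibre_iff_of_forall_not`). Every complex
  scheme isomorphic to an abelian `n`-fold, polarised by any polarisation class, an anchor serving ALL its algebraic classes: every pencil of the
  cell's shape is served at `s₀` by the relative hyperplane class (`hasServedFibre_abelianPolarised_algebraic`), the residual is VACUOUS
  (`under_not_hasServedFibre_abelianPolarised_algebraic`), and the anchored carrier statement IS `PinnedDesignAt 𝒪 n p`
  (`anchoredCarrierAt_abelianPolarised_algebraic_iff`) — PART Z-b §2 recovered. In between: `anchoredCarrierAt_of_pinnedDesignAt` /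
  `anchoredCarrierAt_of_pinnedHodgeDesignAt` (anchors abelian with `θ` a polarisation class, served classes algebraic / Hodge off `Dᵖ`).
* The NECESSITY of a carrier modulo Lefschetz classes at every anchor, and the NON-VACUITY of the partition variable inside the cell's
  binders as soon as one anchor carries a served algebraic non-Lefschetz class, are the companion file `VHCAbelianSchemesRoadServedFibreAnchors`
  (constant pencil through the anchor, PART Z-c).
* §5 (appended) RAY CLOSURE: a carrier serving `w₀` at `(X, θ)` serves every `r·w₀ + q·θᵖ`, `r ≠ 0` (`anchoredCarrierAt_rayClosure`,
  `anchoredCarrierAt_smulClosure`) — served sets may be typed by generators off the `θ`-ray; sums of generators do NOT come for free.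

Intended first instance (ring2 LEAD gen 151 nod N1–N8, skeleton v3 of crux stmt-HodgeConjecture-19787): `𝒪 := twistedReflexiveClass C AdmTw`,
`(n, p) := (6, 3)`, `𝔄 :=` Markman's secant anchors, `𝔖 :=` the honestly served `(3,3)`-classes — `HasServedAnchorFibre := HasServedFibre 6 3 𝔄 𝔖`,
`AnchorCarrier63 C := AnchoredCarrierAt (tw C AdmTw) 6 3 𝔄 𝔖`, `ThroughAnchor63`/`Residual63 := LefAtExceptionalRegimeAtUnder … (HasServedFibre …)`
/ `… (¬ HasServedFibre …)`, N5 := `under_hasServedFibre_of_anchoredCarrierAt`, N7 := `lefAtExceptionalRegimeSixfoldMiddle_of_anchoredCarrierAt_of_under_not`.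

What is NOT claimed: any anchored carrier statement, any residual, any cell, K-SR♭∃, VHC, `HC_AV`, HC; `HC_CM` occurs nowhere.
References: [cite: Bloch1972Semiregularity, Remark (7.5)] [cite: BuchweitzFlenner2003, §5 Thm. 5.1] [cite: vanGeemen1994HodgeAV, §2.4 and Thm. 4.11]
[cite: Markman2025SecantWeil, Thm. 1.4.1 and Thm. 1.5.1] [cite: VoisinHodgeI2002, Thm. 6.25, Thm. 7.10, Thm. 11.30 and §7.1.2]
[cite: Hartshorne1977, II.5 (p. 117)].
-/

noncomputable section

open CategoryTheory CategoryTheory.Limits AlgebraicGeometry Topology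

-- the cell's namespace repeats the summit name (`Summit.HodgeConjecture.HodgeConjecture…`), as in every `Ring2*` file
set_option linter.dupNamespace false

namespace Summit.HodgeConjecture.HodgeConjecture.Ring2.SemiregularRepresentatives

open Literature.AlgebraicGeometry Literature.AlgebraicGeometry.Motives
open Literature.AlgebraicGeometry.HodgeTheory
open Literature.AlgebraicTopology.SingularHomology
open Literature.Barriers.HodgeConjecture (divisorClassesSpan)
open Summit.Ventures.HSemireg (ObjClass)
open Summit.HodgeConjecture.HodgeConjecture.Ring2.Binders (exists_forall_isPolarizationClass_map_fiberι)

variable {𝒪 : ObjClass} {n p : ℕ}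

/-! ## §1 Partition logic: the conditional cell is antitone in its hypothesis; excluded middle -/

/-- **The conditional cell is ANTITONE in its hypothesis**: if `Q f W → P f W` for every pencil and class, then the cell under `P` gives the
cell under `Q`. [folklore] [cite: Bloch1972Semiregularity, Remark (7.5)] -/
theorem under_mono {P Q : ∀ ⦃𝒳 S : SchemeOver ℂ⦄, (𝒳 ⟶ S) → complexBetti 𝒳 (2 * p) → Prop}
    (hQP : ∀ ⦃𝒳 S : SchemeOver ℂ⦄ (f : 𝒳 ⟶ S) (W : complexBetti 𝒳 (2 * p)), Q f W → P f W)
    (h : LefAtExceptionalRegimeAtUnder 𝒪 n p P) : LefAtExceptionalRegimeAtUnder 𝒪 n p Q := by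
  intro 𝒳 S f hf h𝒳 hirr haff hsm hdim hab hsec W hW s₀ halg hexc hQ
  exact h f hf h𝒳 hirr haff hsm hdim hab hsec W hW s₀ halg hexc (hQP f W hQ)

/-- Pointwise-equivalent hypotheses give equivalent conditional cells. [folklore] [cite: Bloch1972Semiregularity, Remark (7.5)] -/
theorem under_congr {P Q : ∀ ⦃𝒳 S : SchemeOver ℂ⦄, (𝒳 ⟶ S) → complexBetti 𝒳 (2 * p) → Prop}
    (hPQ : ∀ ⦃𝒳 S : SchemeOver ℂ⦄ (f : 𝒳 ⟶ S) (W : complexBetti 𝒳 (2 * p)), P f W ↔ Q f W) :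
    LefAtExceptionalRegimeAtUnder 𝒪 n p P ↔ LefAtExceptionalRegimeAtUnder 𝒪 n p Q :=
  ⟨under_mono fun _ _ f W h ↦ (hPQ f W).2 h, under_mono fun _ _ f W h ↦ (hPQ f W).1 h⟩

/-- **PARTITION** (pure logic, no narrowing can hide): the cell under `P` and the cell under `¬P` give the cell — excluded middle on `P f W`.
[folklore] [cite: Bloch1972Semiregularity, Remark (7.5)] [cite: vanGeemen1994HodgeAV, §2.4] -/
theorem lefAtExceptionalRegimeAt_of_under_of_under_not {P : ∀ ⦃𝒳 S : SchemeOver ℂ⦄, (𝒳 ⟶ S) → complexBetti 𝒳 (2 * p) → Prop}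
    (h₁ : LefAtExceptionalRegimeAtUnder 𝒪 n p P)
    (h₂ : LefAtExceptionalRegimeAtUnder 𝒪 n p (fun _ _ f W ↦ ¬ P f W)) : LefAtExceptionalRegimeAt 𝒪 n p := by
  intro 𝒳 S f hf h𝒳 hirr haff hsm hdim hab hsec W hW s₀ halg hexc
  by_cases hP : P f W
  · exact h₁ f hf h𝒳 hirr haff hsm hdim hab hsec W hW s₀ halg hexc hP
  · exact h₂ f hf h𝒳 hirr haff hsm hdim hab hsec W hW s₀ halg hexc hP

/-- **Converse (no slack)**: the cell gives the cell under any hypothesis `P`. [folklore] [cite: Bloch1972Semiregularity, Remark (7.5)] -/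
theorem under_of_lefAtExceptionalRegimeAt (P : ∀ ⦃𝒳 S : SchemeOver ℂ⦄, (𝒳 ⟶ S) → complexBetti 𝒳 (2 * p) → Prop)
    (h : LefAtExceptionalRegimeAt 𝒪 n p) : LefAtExceptionalRegimeAtUnder 𝒪 n p P := by
  intro 𝒳 S f hf h𝒳 hirr haff hsm hdim hab hsec W hW s₀ halg hexc _
  exact h f hf h𝒳 hirr haff hsm hdim hab hsec W hW s₀ halg hexc

/-- **The cell ⟺ the cell under `P` ∧ the cell under `¬P`**, for every pencil-level predicate `P`. [folklore]
[cite: Bloch1972Semiregularity, Remark (7.5)] [cite: vanGeemen1994HodgeAV, §2.4] -/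
theorem lefAtExceptionalRegimeAt_iff_under_and_under_not (P : ∀ ⦃𝒳 S : SchemeOver ℂ⦄, (𝒳 ⟶ S) → complexBetti 𝒳 (2 * p) → Prop) :
    LefAtExceptionalRegimeAt 𝒪 n p ↔
      LefAtExceptionalRegimeAtUnder 𝒪 n p P ∧ LefAtExceptionalRegimeAtUnder 𝒪 n p (fun _ _ f W ↦ ¬ P f W) :=
  ⟨fun h ↦ ⟨under_of_lefAtExceptionalRegimeAt P h, under_of_lefAtExceptionalRegimeAt _ h⟩,
    fun h ↦ lefAtExceptionalRegimeAt_of_under_of_under_not h.1 h.2⟩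

/-- **Two pieces at once**: the cell under `P ∨ Q` ⟺ the cell under `P` ∧ the cell under `Q` (so with two anchor families the residual is the
cell under `¬P ∧ ¬Q`). [folklore] [cite: Bloch1972Semiregularity, Remark (7.5)] -/
theorem under_or_iff {P Q : ∀ ⦃𝒳 S : SchemeOver ℂ⦄, (𝒳 ⟶ S) → complexBetti 𝒳 (2 * p) → Prop} :
    LefAtExceptionalRegimeAtUnder 𝒪 n p (fun _ _ f W ↦ P f W ∨ Q f W) ↔
      LefAtExceptionalRegimeAtUnder 𝒪 n p P ∧ LefAtExceptionalRegimeAtUnder 𝒪 n p Q := by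
  refine ⟨fun h ↦ ⟨under_mono (fun _ _ f W hP ↦ Or.inl hP) h, under_mono (fun _ _ f W hQ ↦ Or.inr hQ) h⟩, fun h ↦ ?_⟩
  intro 𝒳 S f hf h𝒳 hirr haff hsm hdim hab hsec W hW s₀ halg hexc hPQ
  rcases hPQ with hP | hQ
  · exact h.1 f hf h𝒳 hirr haff hsm hdim hab hsec W hW s₀ halg hexc hP
  · exact h.2 f hf h𝒳 hirr haff hsm hdim hab hsec W hW s₀ halg hexc hQ

/-- **Two anchor families**: the cell under `P`, the cell under `Q` and the residual under `¬P ∧ ¬Q` give the cell. [folklore]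
[cite: Bloch1972Semiregularity, Remark (7.5)] [cite: vanGeemen1994HodgeAV, §2.4] -/
theorem lefAtExceptionalRegimeAt_of_under_of_under_of_under_not_not
    {P Q : ∀ ⦃𝒳 S : SchemeOver ℂ⦄, (𝒳 ⟶ S) → complexBetti 𝒳 (2 * p) → Prop}
    (h₁ : LefAtExceptionalRegimeAtUnder 𝒪 n p P) (h₂ : LefAtExceptionalRegimeAtUnder 𝒪 n p Q)
    (h₃ : LefAtExceptionalRegimeAtUnder 𝒪 n p (fun _ _ f W ↦ ¬ P f W ∧ ¬ Q f W)) : LefAtExceptionalRegimeAt 𝒪 n p :=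
  lefAtExceptionalRegimeAt_of_under_of_under_not (P := fun _ _ f W ↦ P f W ∨ Q f W) (under_or_iff.2 ⟨h₁, h₂⟩)
    (under_mono (fun _ _ _ _ h ↦ not_or.1 h) h₃)

/-- The cell under the trivial hypothesis is the cell. [folklore] [cite: Bloch1972Semiregularity, Remark (7.5)] -/
theorem under_true_iff : LefAtExceptionalRegimeAtUnder 𝒪 n p (fun _ _ _ _ ↦ True) ↔ LefAtExceptionalRegimeAt 𝒪 n p :=
  ⟨fun h _ _ f hf h𝒳 hirr haff hsm hdim hab hsec W hW s₀ halg hexc ↦ h f hf h𝒳 hirr haff hsm hdim hab hsec W hW s₀ halg hexc trivial,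
    under_of_lefAtExceptionalRegimeAt _⟩

/-- **An unsatisfiable hypothesis gives a VACUOUS piece** (the warning behind the tribunal's «no cosmetic split»: if the through-anchor
predicate is never satisfied, the residual IS the cell). [folklore] [cite: Bloch1972Semiregularity, Remark (7.5)] -/
theorem under_of_forall_not (P : ∀ ⦃𝒳 S : SchemeOver ℂ⦄, (𝒳 ⟶ S) → complexBetti 𝒳 (2 * p) → Prop)
    (hP : ∀ ⦃𝒳 S : SchemeOver ℂ⦄ (f : 𝒳 ⟶ S) (W : complexBetti 𝒳 (2 * p)), ¬ P f W) :
    LefAtExceptionalRegimeAtUnder 𝒪 n p P := by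
  intro 𝒳 S f hf h𝒳 hirr haff hsm hdim hab hsec W hW s₀ halg hexc h
  exact absurd h (hP f W)

/-- If `P` is never satisfied, the cell under `¬P` is the whole cell. [folklore] [cite: Bloch1972Semiregularity, Remark (7.5)] -/
theorem under_not_iff_of_forall_not (P : ∀ ⦃𝒳 S : SchemeOver ℂ⦄, (𝒳 ⟶ S) → complexBetti 𝒳 (2 * p) → Prop)
    (hP : ∀ ⦃𝒳 S : SchemeOver ℂ⦄ (f : 𝒳 ⟶ S) (W : complexBetti 𝒳 (2 * p)), ¬ P f W) :
    LefAtExceptionalRegimeAtUnder 𝒪 n p (fun _ _ f W ↦ ¬ P f W) ↔ LefAtExceptionalRegimeAt 𝒪 n p :=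
  ⟨fun h ↦ lefAtExceptionalRegimeAt_of_under_of_under_not (under_of_forall_not P hP) h, under_of_lefAtExceptionalRegimeAt _⟩

/-! ## §2 Transport along pencils through a served fibre; anchored carrier ∧ residual ⟹ cell -/

variable {𝔄 : ∀ X : SchemeOver ℂ, complexBetti X 2 → Prop} {𝔖 : ∀ (X : SchemeOver ℂ), complexBetti X 2 → Set (complexBetti X (2 * p))}
variable {𝒳 S : SchemeOver ℂ} {f : 𝒳 ⟶ S}

/-- **TRANSPORT: an anchored carrier at a served fibre is a K-SR♭∃ datum for the pencil** (door-, degree-, anchor-generic; fact-free; NO regime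
hypothesis, no hypothesis on the base). `f` a smooth projective family of relative dimension `n`, `W` fibrewise rational of type `(p,p)`, with a
served fibre `sₐ` (global `Θ` with rational `(1,1)` restrictions, `(𝒳_{sₐ}, Θ|)` an anchor, `W|_{sₐ}` served): the carrier `(I ∋ p, κ)` ON `𝒳_{sₐ}`
with `κ_p = a·W| + c_p·(Θ|)ᵖ`, `κ_q = c_q·(Θ|)^q` is a K-SR♭∃ datum via `V_p := a·W + c_p·Θᵖ`, `V_q := c_q·Θ^q`, `Z := c_p·Θᵖ` — PART Z-b §5.
[cite: Bloch1972Semiregularity, Remark (7.5)] [cite: Markman2025SecantWeil, Thm. 1.4.1] [cite: VoisinHodgeI2002, Thm. 11.30 and §7.1.2] -/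
theorem exists_lefAtDatum_of_anchoredCarrierAt (hA : AnchoredCarrierAt 𝒪 n p 𝔄 𝔖) (hf : IsSmoothProjectiveFamily f n)
    (W : complexBetti 𝒳 (2 * p))
    (hW : ∀ s : ComplexPoints S, IsRationalClass (complexBetti.map (fiberι f s) (2 * p) W) ∧
      IsOfHodgeType n (fiberOver f s) (2 * p) p p (complexBetti.map (fiberι f s) (2 * p) W))
    (hsf : HasServedFibre n p 𝔄 𝔖 f W) :
    ∃ (s₁ : ComplexPoints S) (I : Finset ℕ) (κ : (q : ℕ) → complexBetti (fiberOver f s₁) (2 * q))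
      (V : (q : ℕ) → complexBetti 𝒳 (2 * q)) (a : ℂ) (Z : complexBetti 𝒳 (2 * p)),
      p ∈ I ∧ 𝒪 n (fiberOver f s₁) I κ ∧ a ≠ 0 ∧
      (∀ s : ComplexPoints S,
        complexBetti.map (fiberι f s) (2 * p) Z ∈ algebraicClasses (fiberOver f s) p ∧
        complexBetti.map (fiberι f s) (2 * p) Z ∈ divisorClassesSpan (fiberOver f s) n p) ∧
      V p = a • W + Z ∧
      (∀ q ∈ I, κ q = complexBetti.map (fiberι f s₁) (2 * q) (V q)) ∧
      (∀ q ∈ I, ∀ s : ComplexPoints S, IsOfHodgeType n (fiberOver f s) (2 * q) q q (complexBetti.map (fiberι f s) (2 * q) (V q))) := by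
  obtain ⟨sₐ, Θ, hΘQ, hΘH, hanc, hserved⟩ := hsf
  obtain ⟨I, κ, a, c, hpI, h𝒪, ha, hκp, hκq⟩ := hA (fiberOver f sₐ) _ hanc _ hserved (hW sₐ).1
  exact exists_lefAtDatum_of_pinnedDatum_at hf Θ hΘQ hΘH W (fun s ↦ (hW s).2) hpI h𝒪 ha hκp hκq

/-- **THE ANCHORED CARRIER STATEMENT GIVES THE CELL ON EVERY PENCIL THROUGH A SERVED FIBRE** (the «through-anchor» piece of the partition is
kernel glue over the per-variety carrier statement). [cite: Bloch1972Semiregularity, Remark (7.5)] [cite: Markman2025SecantWeil, Thm. 1.4.1 and Thm. 1.5.1]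
[cite: VoisinHodgeI2002, Thm. 11.30 and §7.1.2] -/
theorem under_hasServedFibre_of_anchoredCarrierAt (hA : AnchoredCarrierAt 𝒪 n p 𝔄 𝔖) :
    LefAtExceptionalRegimeAtUnder 𝒪 n p (HasServedFibre n p 𝔄 𝔖) := by
  intro 𝒳 S f hf h𝒳 hirr haff hsm hdim hab hsec W hW s₀ halg hexc hsf
  exact exists_lefAtDatum_of_anchoredCarrierAt hA hf W hW hsf

/-- **ANCHORED CARRIER ∧ RESIDUAL ⟹ THE CELL `(n, p)`**: the per-variety carrier statement at the anchors and the cell for the pencils with NO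
served fibre give regime 2 at `(n, p)` (transport + excluded middle). [cite: Bloch1972Semiregularity, Remark (7.5)]
[cite: vanGeemen1994HodgeAV, §2.4 and Thm. 4.11] [cite: Markman2025SecantWeil, Thm. 1.4.1 and Thm. 1.5.1] -/
theorem lefAtExceptionalRegimeAt_of_anchoredCarrierAt_of_under_not (hA : AnchoredCarrierAt 𝒪 n p 𝔄 𝔖)
    (hR : LefAtExceptionalRegimeAtUnder 𝒪 n p (fun _ _ f W ↦ ¬ HasServedFibre n p 𝔄 𝔖 f W)) :
    LefAtExceptionalRegimeAt 𝒪 n p :=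
  lefAtExceptionalRegimeAt_of_under_of_under_not (under_hasServedFibre_of_anchoredCarrierAt hA) hR

/-- **The `(6, 3)` RUNG from an anchored carrier statement at `(6, 3)` and its residual** (`LefAtExceptionalRegimeSixfoldMiddle 𝒪 ↔
LefAtExceptionalRegimeAt 𝒪 6 3` is `Iff.rfl`). The shape of skeleton v3 of crux stmt-HodgeConjecture-19787: rung ⟸ anchor-carrier stub ∧ residual
stub. [cite: Markman2025SecantWeil, Thm. 1.4.1 and Thm. 1.5.1] [cite: vanGeemen1994HodgeAV, Thm. 4.11] [cite: Bloch1972Semiregularity, Remark (7.5)] -/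
theorem lefAtExceptionalRegimeSixfoldMiddle_of_anchoredCarrierAt_of_under_not
    {𝔖₃ : ∀ (X : SchemeOver ℂ), complexBetti X 2 → Set (complexBetti X (2 * 3))} (hA : AnchoredCarrierAt 𝒪 6 3 𝔄 𝔖₃)
    (hR : LefAtExceptionalRegimeAtUnder 𝒪 6 3 (fun _ _ f W ↦ ¬ HasServedFibre 6 3 𝔄 𝔖₃ f W)) :
    LefAtExceptionalRegimeSixfoldMiddle 𝒪 :=
  lefAtExceptionalRegimeSixfoldMiddle_iff_at.2 (lefAtExceptionalRegimeAt_of_anchoredCarrierAt_of_under_not hA hR)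

/-- **Both regimes when every pencil is served**: if EVERY one-parameter abelian scheme of the cell's shape with `W` algebraic at `s₀` has a served
fibre, the anchored carrier statement gives the full K-SR♭∃ statement `AdmissibleRepresentativesLefAtDeg 𝒪 n p` (no regime hypothesis is used by the
transport). [cite: Bloch1972Semiregularity, Remark (7.5)] [cite: vanGeemen1994HodgeAV, §2.4] -/
theorem admissibleRepresentativesLefAtDeg_of_anchoredCarrierAt_of_forall_hasServedFibre (hA : AnchoredCarrierAt 𝒪 n p 𝔄 𝔖)
    (hall : ∀ ⦃𝒳 S : SchemeOver ℂ⦄ (f : 𝒳 ⟶ S), IsSmoothProjectiveFamily f n → IsQuasiProjectiveOver 𝒳 → IsAffine S.left →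
      (∀ s : ComplexPoints S, ∃ A' : AbelianVariety ℂ, A'.dim = n ∧ Nonempty (A'.X ≅ fiberOver f s)) →
      ∀ (W : complexBetti 𝒳 (2 * p)),
        (∀ s : ComplexPoints S, IsRationalClass (complexBetti.map (fiberι f s) (2 * p) W) ∧
          IsOfHodgeType n (fiberOver f s) (2 * p) p p (complexBetti.map (fiberι f s) (2 * p) W)) →
        ∀ s₀ : ComplexPoints S, complexBetti.map (fiberι f s₀) (2 * p) W ∈ algebraicClasses (fiberOver f s₀) p →
          HasServedFibre n p 𝔄 𝔖 f W) :
    AdmissibleRepresentativesLefAtDeg 𝒪 n p := by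
  intro 𝒳 S f hf h𝒳 hirr haff hsm hdim hab hsec W hW s₀ halg
  exact exists_lefAtDatum_of_anchoredCarrierAt hA hf W hW (hall f hf h𝒳 haff hab W hW s₀ halg)

/-! ## §3 Monotonicity in the anchor data: unserved directions are residual, by logic -/

variable {𝔄' : ∀ X : SchemeOver ℂ, complexBetti X 2 → Prop} {𝔖' : ∀ (X : SchemeOver ℂ), complexBetti X 2 → Set (complexBetti X (2 * p))}

/-- Enlarging the anchor predicate and the served sets preserves served fibres. [folklore] [cite: Bloch1972Semiregularity, Remark (7.5)] -/
theorem hasServedFibre_mono (h𝔄 : ∀ (X : SchemeOver ℂ) (θ : complexBetti X 2), 𝔄 X θ → 𝔄' X θ)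
    (h𝔖 : ∀ (X : SchemeOver ℂ) (θ : complexBetti X 2), 𝔄 X θ → 𝔖 X θ ⊆ 𝔖' X θ) (W : complexBetti 𝒳 (2 * p))
    (h : HasServedFibre n p 𝔄 𝔖 f W) : HasServedFibre n p 𝔄' 𝔖' f W := by
  obtain ⟨sₐ, Θ, hΘQ, hΘH, hanc, hserved⟩ := h
  exact ⟨sₐ, Θ, hΘQ, hΘH, h𝔄 _ _ hanc, h𝔖 _ _ hanc hserved⟩

/-- **The anchored carrier statement is ANTITONE in the anchor data**: more anchors / more served classes = a STRONGER statement. [folklore]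
[cite: Bloch1972Semiregularity, Remark (7.5)] -/
theorem anchoredCarrierAt_anti (h𝔄 : ∀ (X : SchemeOver ℂ) (θ : complexBetti X 2), 𝔄 X θ → 𝔄' X θ)
    (h𝔖 : ∀ (X : SchemeOver ℂ) (θ : complexBetti X 2), 𝔄 X θ → 𝔖 X θ ⊆ 𝔖' X θ) (h : AnchoredCarrierAt 𝒪 n p 𝔄' 𝔖') :
    AnchoredCarrierAt 𝒪 n p 𝔄 𝔖 :=
  fun X θ hXθ w hw hwQ ↦ h X θ (h𝔄 X θ hXθ) w (h𝔖 X θ hXθ hw) hwQ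

/-- **The residual is MONOTONE in the anchor data**: more anchors / more served classes = a WEAKER residual. [folklore]
[cite: Bloch1972Semiregularity, Remark (7.5)] -/
theorem under_not_hasServedFibre_mono (h𝔄 : ∀ (X : SchemeOver ℂ) (θ : complexBetti X 2), 𝔄 X θ → 𝔄' X θ)
    (h𝔖 : ∀ (X : SchemeOver ℂ) (θ : complexBetti X 2), 𝔄 X θ → 𝔖 X θ ⊆ 𝔖' X θ)
    (h : LefAtExceptionalRegimeAtUnder 𝒪 n p (fun _ _ f W ↦ ¬ HasServedFibre n p 𝔄 𝔖 f W)) :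
    LefAtExceptionalRegimeAtUnder 𝒪 n p (fun _ _ f W ↦ ¬ HasServedFibre n p 𝔄' 𝔖' f W) :=
  under_mono (fun _ _ _ W h' h ↦ h' (hasServedFibre_mono h𝔄 h𝔖 W h)) h

/-- The through-anchor piece is ANTITONE in the anchor data (a bigger served set asks the carrier statement for more). [folklore]
[cite: Bloch1972Semiregularity, Remark (7.5)] -/
theorem under_hasServedFibre_anti (h𝔄 : ∀ (X : SchemeOver ℂ) (θ : complexBetti X 2), 𝔄 X θ → 𝔄' X θ)
    (h𝔖 : ∀ (X : SchemeOver ℂ) (θ : complexBetti X 2), 𝔄 X θ → 𝔖 X θ ⊆ 𝔖' X θ)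
    (h : LefAtExceptionalRegimeAtUnder 𝒪 n p (HasServedFibre n p 𝔄' 𝔖')) :
    LefAtExceptionalRegimeAtUnder 𝒪 n p (HasServedFibre n p 𝔄 𝔖) :=
  under_mono (fun _ _ _ W h' ↦ hasServedFibre_mono h𝔄 h𝔖 W h') h

/-- **«UNSERVED ANCHOR DIRECTIONS ARE ONE MORE RESIDUAL SUB-CELL», BY LOGIC**: for nested anchor data `(𝔄, 𝔖) ≤ (𝔄', 𝔖')`, the residual of the
SMALLER data ⟺ the residual of the LARGER data ∧ the cell for the pencils served by the larger data only. [folklore]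
[cite: Bloch1972Semiregularity, Remark (7.5)] [cite: Markman2025SecantWeil, Thm. 1.4.1] -/
theorem under_not_iff_under_not_and_under_sdiff (h𝔄 : ∀ (X : SchemeOver ℂ) (θ : complexBetti X 2), 𝔄 X θ → 𝔄' X θ)
    (h𝔖 : ∀ (X : SchemeOver ℂ) (θ : complexBetti X 2), 𝔄 X θ → 𝔖 X θ ⊆ 𝔖' X θ) :
    LefAtExceptionalRegimeAtUnder 𝒪 n p (fun _ _ f W ↦ ¬ HasServedFibre n p 𝔄 𝔖 f W) ↔
      LefAtExceptionalRegimeAtUnder 𝒪 n p (fun _ _ f W ↦ ¬ HasServedFibre n p 𝔄' 𝔖' f W) ∧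
        LefAtExceptionalRegimeAtUnder 𝒪 n p
          (fun _ _ f W ↦ HasServedFibre n p 𝔄' 𝔖' f W ∧ ¬ HasServedFibre n p 𝔄 𝔖 f W) := by
  rw [← under_or_iff]
  refine under_congr fun 𝒳 S f W ↦ ⟨fun h ↦ ?_, fun h ↦ ?_⟩
  · by_cases h' : HasServedFibre n p 𝔄' 𝔖' f W
    · exact Or.inr ⟨h', h⟩
    · exact Or.inl h'
  · rcases h with h' | ⟨-, h⟩
    · exact fun h ↦ h' (hasServedFibre_mono h𝔄 h𝔖 W h)
    · exact h

/-! ## §4 The two extremes; the anchored carrier statement from the pinned designs -/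

/-- **NO ANCHORS: the residual IS the cell.** [folklore] [cite: Bloch1972Semiregularity, Remark (7.5)] [cite: vanGeemen1994HodgeAV, §2.4] -/
theorem under_not_hasServedFibre_iff_of_forall_not (h𝔄 : ∀ (X : SchemeOver ℂ) (θ : complexBetti X 2), ¬ 𝔄 X θ) :
    LefAtExceptionalRegimeAtUnder 𝒪 n p (fun _ _ f W ↦ ¬ HasServedFibre n p 𝔄 𝔖 f W) ↔ LefAtExceptionalRegimeAt 𝒪 n p :=
  under_not_iff_of_forall_not _ fun _ _ _ _ ⟨_, _, _, _, hanc, _⟩ ↦ h𝔄 _ _ hanc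

/-- No anchors: the anchored carrier statement is trivially true. [folklore] [cite: Bloch1972Semiregularity, Remark (7.5)] -/
theorem anchoredCarrierAt_of_forall_not (h𝔄 : ∀ (X : SchemeOver ℂ) (θ : complexBetti X 2), ¬ 𝔄 X θ) :
    AnchoredCarrierAt 𝒪 n p 𝔄 𝔖 :=
  fun X θ hXθ ↦ absurd hXθ (h𝔄 X θ)

/-- **The anchored carrier statement from the PINNED DESIGN PROBLEM**: if every anchor is (isomorphic to) an abelian `n`-fold with `θ` a
polarisation class and every served class is algebraic, `PinnedDesignAt 𝒪 n p` gives `AnchoredCarrierAt 𝒪 n p 𝔄 𝔖` (localisation).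
[cite: Bloch1972Semiregularity, Remark (7.5)] [cite: Andre1996Motifs, §1.1 (p. 10)] -/
theorem anchoredCarrierAt_of_pinnedDesignAt (h : PinnedDesignAt 𝒪 n p)
    (h𝔄 : ∀ (X : SchemeOver ℂ) (θ : complexBetti X 2), 𝔄 X θ →
      (∃ A : AbelianVariety ℂ, A.dim = n ∧ Nonempty (A.X ≅ X)) ∧ IsPolarizationClass n X θ)
    (h𝔖 : ∀ (X : SchemeOver ℂ) (θ : complexBetti X 2), 𝔄 X θ → ∀ w ∈ 𝔖 X θ, w ∈ algebraicClasses X p) :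
    AnchoredCarrierAt 𝒪 n p 𝔄 𝔖 :=
  fun X θ hXθ w hw hwQ ↦ h X (h𝔄 X θ hXθ).1 θ (h𝔄 X θ hXθ).2 w hwQ (h𝔖 X θ hXθ w hw)

/-- **The anchored carrier statement from the PINNED HODGE DESIGN PROBLEM**: anchors abelian with `θ` a polarisation class, served classes of
type `(p,p)` OFF the Lefschetz span `Dᵖ ⊗ ℂ`. [cite: Bloch1972Semiregularity, Remark (7.5)] [cite: vanGeemen1994HodgeAV, §2.4 and Thm. 4.11] -/
theorem anchoredCarrierAt_of_pinnedHodgeDesignAt (h : PinnedHodgeDesignAt 𝒪 n p)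
    (h𝔄 : ∀ (X : SchemeOver ℂ) (θ : complexBetti X 2), 𝔄 X θ →
      (∃ A : AbelianVariety ℂ, A.dim = n ∧ Nonempty (A.X ≅ X)) ∧ IsPolarizationClass n X θ)
    (h𝔖 : ∀ (X : SchemeOver ℂ) (θ : complexBetti X 2), 𝔄 X θ → ∀ w ∈ 𝔖 X θ,
      IsOfHodgeType n X (2 * p) p p w ∧ w ∉ divisorClassesSpan X n p) :
    AnchoredCarrierAt 𝒪 n p 𝔄 𝔖 :=
  fun X θ hXθ w hw hwQ ↦
    h X (h𝔄 X θ hXθ).1 θ (h𝔄 X θ hXθ).2 w hwQ (h𝔖 X θ hXθ w hw).1 (h𝔖 X θ hXθ w hw).2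

/-- **ALL POLARISED ABELIAN `n`-FOLDS AS ANCHORS, ALL ALGEBRAIC CLASSES SERVED: every pencil of the cell's shape is served at `s₀`** — by the
relative hyperplane class `Θ` of the quasi-projective total space (ring2-b02's `exists_forall_isPolarizationClass_map_fiberι`: rational,
supported on a divisor, hard Lefschetz on every fibre). [cite: VoisinHodgeI2002, Thm. 6.25, Thm. 7.10 and §7.1.2] [cite: Hartshorne1977, II.5 (p. 117)] -/
theorem hasServedFibre_abelianPolarised_algebraic (hf : IsSmoothProjectiveFamily f n) (h𝒳 : IsQuasiProjectiveOver 𝒳) [IsAffine S.left]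
    (hab : ∀ s : ComplexPoints S, ∃ A' : AbelianVariety ℂ, A'.dim = n ∧ Nonempty (A'.X ≅ fiberOver f s))
    (W : complexBetti 𝒳 (2 * p)) (s₀ : ComplexPoints S)
    (halg : complexBetti.map (fiberι f s₀) (2 * p) W ∈ algebraicClasses (fiberOver f s₀) p) :
    HasServedFibre n p (fun X θ ↦ (∃ A : AbelianVariety ℂ, A.dim = n ∧ Nonempty (A.X ≅ X)) ∧ IsPolarizationClass n X θ)
      (fun X _ ↦ (algebraicClasses X p : Set (complexBetti X (2 * p)))) f W := by
  haveI : IsSeparated S.hom := isSeparated_hom_of_isAffine S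
  obtain ⟨Θ, hΘ⟩ := exists_forall_isPolarizationClass_map_fiberι f hf h𝒳
  exact ⟨s₀, Θ, fun s ↦ (hΘ s).isRationalClass,
    fun s ↦ isOfHodgeType_of_mem_algebraicClasses_of_isSmoothProjective (hf.isSmoothProjective s) 1 (hΘ s).mem_algebraicClasses,
    ⟨hab s₀, hΘ s₀⟩, halg⟩

/-- **… hence the residual of the full anchor data is VACUOUS** (holds for every door and degree). [cite: VoisinHodgeI2002, Thm. 6.25 and Thm. 7.10]
[cite: Bloch1972Semiregularity, Remark (7.5)] -/
theorem under_not_hasServedFibre_abelianPolarised_algebraic :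
    LefAtExceptionalRegimeAtUnder 𝒪 n p (fun _ _ f W ↦ ¬ HasServedFibre n p
      (fun X θ ↦ (∃ A : AbelianVariety ℂ, A.dim = n ∧ Nonempty (A.X ≅ X)) ∧ IsPolarizationClass n X θ)
      (fun X _ ↦ (algebraicClasses X p : Set (complexBetti X (2 * p)))) f W) := by
  intro 𝒳 S f hf h𝒳 hirr haff hsm hdim hab hsec W hW s₀ halg hexc h
  exact absurd (hasServedFibre_abelianPolarised_algebraic hf h𝒳 hab W s₀ halg) h

/-- **… and the anchored carrier statement of the full anchor data IS the pinned design problem** `PinnedDesignAt 𝒪 n p` (currying).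
[cite: Bloch1972Semiregularity, Remark (7.5)] [cite: Andre1996Motifs, §1.1 (p. 10)] -/
theorem anchoredCarrierAt_abelianPolarised_algebraic_iff :
    AnchoredCarrierAt 𝒪 n p (fun X θ ↦ (∃ A : AbelianVariety ℂ, A.dim = n ∧ Nonempty (A.X ≅ X)) ∧ IsPolarizationClass n X θ)
      (fun X _ ↦ (algebraicClasses X p : Set (complexBetti X (2 * p)))) ↔ PinnedDesignAt 𝒪 n p :=
  ⟨fun h X hX θ hθ w hwQ hwalg ↦ h X θ ⟨hX, hθ⟩ w hwalg hwQ, fun h X θ hXθ w hw hwQ ↦ h X hXθ.1 θ hXθ.2 w hwQ hw⟩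

/-- **PART Z-b §2 recovered through the partition**: with the full anchor data, anchored carrier (= pinned design) ∧ residual (vacuous) ⟹ regime 2
at `(n, p)`. [cite: Bloch1972Semiregularity, Remark (7.5)] [cite: vanGeemen1994HodgeAV, §2.4] [cite: VoisinHodgeI2002, Thm. 6.25 and Thm. 7.10] -/
theorem lefAtExceptionalRegimeAt_of_pinnedDesignAt' (h : PinnedDesignAt 𝒪 n p) : LefAtExceptionalRegimeAt 𝒪 n p :=
  lefAtExceptionalRegimeAt_of_anchoredCarrierAt_of_under_not (anchoredCarrierAt_abelianPolarised_algebraic_iff.2 h)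
    under_not_hasServedFibre_abelianPolarised_algebraic

/-! ## §5 Served sets are effectively closed under rescaling and the `θ`-ray (ab-andre-2 gen 58, appended)

Bookkeeping for the typing of an honest served set (ring2 LEAD gen 151, finding F1): a carrier serving `w₀` at the anchor `(X, θ)` —
`κ_p = a·w₀ + c_p·θᵖ` — serves every `w = r·w₀ + q·θᵖ` with `r ≠ 0` by re-reading the same datum (`κ_p = (a/r)·w + (c_p − aq/r)·θᵖ`). So a
served set may be typed by its GENERATORS off the `θ`-ray (e.g. the Hodge–Weil parts of the `κ_p` of the printed sheaves and of their pull-backs);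
the punctured `ℂ`-planes `ℂ^× · w₀ + ℂ · θᵖ` come for free. What does NOT come for free (F1): sums `w₀ + w₀'` of two served generators — direct sums
of semiregular objects need not be semiregular. -/

/-- **RAY CLOSURE of the served sets**: an anchored carrier statement for `(𝔄, 𝔖)` gives the anchored carrier statement for the served sets
enlarged to `{r·w₀ + q·θᵖ : w₀ ∈ 𝔖 X θ rational, r ≠ 0}` (same anchors) — the datum serving `w₀` serves `w`, with `a' = a/r`,
`c'_p = c_p − a·q/r`, other side coefficients unchanged. [cite: Bloch1972Semiregularity, Remark (7.5)] [cite: Markman2025SecantWeil, Thm. 1.4.1] -/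
theorem anchoredCarrierAt_rayClosure (h : AnchoredCarrierAt 𝒪 n p 𝔄 𝔖) :
    AnchoredCarrierAt 𝒪 n p 𝔄 (fun X θ ↦ {w | ∃ w₀ ∈ 𝔖 X θ, IsRationalClass w₀ ∧
      ∃ r q : ℂ, r ≠ 0 ∧ w = r • w₀ + q • cupPowTwo θ p}) := by
  rintro X θ hXθ w ⟨w₀, hw₀, hw₀Q, r, q, hr, hw⟩ -
  obtain ⟨I, κ, a, c, hpI, h𝒪, ha, hκp, hκq⟩ := h X θ hXθ w₀ hw₀ hw₀Q
  refine ⟨I, κ, a * r⁻¹, Function.update c p (c p - a * r⁻¹ * q), hpI, h𝒪, mul_ne_zero ha (inv_ne_zero hr), ?_,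
    fun q' hq' hq'p ↦ by rw [Function.update_of_ne hq'p]; exact hκq q' hq' hq'p⟩
  have hw₀' : w₀ = r⁻¹ • (w - q • cupPowTwo θ p) := by
    rw [hw, add_sub_cancel_right, smul_smul, inv_mul_cancel₀ hr, one_smul]
  rw [Function.update_self, hκp, hw₀']
  module

/-- **In particular every served generator serves its punctured ray**: `AnchoredCarrierAt` for `𝔖` gives it for
`{r·w₀ : w₀ ∈ 𝔖 X θ rational, r ≠ 0}`. [cite: Bloch1972Semiregularity, Remark (7.5)] -/
theorem anchoredCarrierAt_smulClosure (h : AnchoredCarrierAt 𝒪 n p 𝔄 𝔖) :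
    AnchoredCarrierAt 𝒪 n p 𝔄 (fun X θ ↦ {w | ∃ w₀ ∈ 𝔖 X θ, IsRationalClass w₀ ∧ ∃ r : ℂ, r ≠ 0 ∧ w = r • w₀}) :=
  by
  refine anchoredCarrierAt_anti (𝔄' := 𝔄) (fun _ _ h ↦ h) (fun X θ _ w hw ↦ ?_) (anchoredCarrierAt_rayClosure h)
  obtain ⟨w₀, hw₀, hw₀Q, r, hr, hw⟩ := hw
  exact ⟨w₀, hw₀, hw₀Q, r, 0, hr, by rw [hw, zero_smul, add_zero]⟩

/-- **… and the `θ`-ray itself is served as soon as ONE rational class is served at the anchor** (`w = θᵖ = 0·w₀ + …` is NOT of the form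
`r·w₀ + q·θᵖ` with `r ≠ 0` unless `θᵖ` and `w₀` are dependent — so this is the honest statement: the classes `r·w₀ + q·θᵖ`, `r ≠ 0`; the bare ray
`ℂ·θᵖ` is served by NULL data when the door has them, PART Z-b §4 `pinnedDesign_of_mem_span_cupPowTwo_of_hasNullDatum`). Recorded as the
monotonicity instance: the residual of the ray-closed served sets is implied by the residual of `𝔖`. [cite: Bloch1972Semiregularity, Remark (7.5)] -/
theorem under_not_hasServedFibre_rayClosure
    (h : LefAtExceptionalRegimeAtUnder 𝒪 n p (fun _ _ f W ↦ ¬ HasServedFibre n p 𝔄 𝔖 f W))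
    (h𝔖Q : ∀ (X : SchemeOver ℂ) (θ : complexBetti X 2), 𝔄 X θ → ∀ w ∈ 𝔖 X θ, IsRationalClass w) :
    LefAtExceptionalRegimeAtUnder 𝒪 n p (fun _ _ f W ↦ ¬ HasServedFibre n p 𝔄 (fun X θ ↦ {w | ∃ w₀ ∈ 𝔖 X θ, IsRationalClass w₀ ∧
      ∃ r q : ℂ, r ≠ 0 ∧ w = r • w₀ + q • cupPowTwo θ p}) f W) :=
  by
  refine under_not_hasServedFibre_mono (𝔄' := 𝔄) (fun _ _ h ↦ h) (fun X θ hXθ w hw ↦ ?_) h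
  exact ⟨w, hw, h𝔖Q X θ hXθ w hw, 1, 0, one_ne_zero, by rw [one_smul, zero_smul, add_zero]⟩

end Summit.HodgeConjecture.HodgeConjecture.Ring2.SemiregularRepresentatives

end
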